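import Literature.IUT.LogVolume.ExplicitEstimatesTheorem53FromCor52
import Literature.IUT.LogVolume.ExplicitEstimatesHeightsComparison
import Literature.NumberTheory.DiophantineGeometry.GenEllNorthcottProofs
import HarnessLib

/-!
# [ExpEst] Cor. 5.2, proof: "there is only a finite number of possibilities for the `j`-invariant of `E_F`" —
# finiteness of the exceptional sets of the mono-complex version, PROVED (height of `λ` against the height of `j(λ)`)

S. Mochizuki, I. Fesenko, Y. Hoshi, A. Minamide, W. Porowski, *Explicit estimates in inter-universal Teichmüller
theory*, Kodai Math. J. **45** (2022) 175–236 — [ExpEst], bib key `MochizukiEtAl2022`. Proof of Cor. 5.2, pp. 213,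
215, 218 (pdf p39.l13–20, p41.l5–8, p44.l23–30 of the cell render `…/abc-iut/plan/repair/lit/renders/MFHMP-
ExplicitEstimates-Kodai2022-book-anonnd-eeiutp`; journal page = pdf page + 174): each exclusion of the proof — "`h^{1/2}
< 10^15·d`", the (P4) bound "`h ≤ 5.12·10⁻¹³`", "`h < h_d(ε)`" — ends with "it follows … (respectively, from Proposition
1.9, (iii), of the present paper) that [this] implies that there is only a finite number of possibilities for the
`j`-invariant of `E_F`. Thus, by possibly enlarging the finite set … `𝔈𝔵𝔠^mcx_{d,ε}`, we may assume without loss of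
generality that …". This file kernel-checks that sentence in the form the tree's candidate `ExpEst.PartMcx` needs:
for every `d` and `B`, the set of points `λ ∈ U_X(ℚ̄)^{≤d}` (minimally presented) over a MONO-COMPLEX field with
`log(𝔮^∀(λ)) ≤ B` has finitely many points (`GenEll.HasFinitelyManyPoints`, finitely many minimal polynomials) —
`hasFinitelyManyPoints_mcx_logQForall_le`. CLASSICAL; TAKES NO SIDE on [IUTchIII] Cor. 3.12; no abc claim. Cell
abc-iut, seat lit-abc-explicitiut (gen 4).

Route (all inputs are tree theorems): `log(𝔮^∀(λ)) = h_non(j(λ))` (Remark 1.10.1, `ExpEst.logQForall_eq_hNon`);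
Prop. 1.9 for mono-complex fields, `h(j(λ)) ≤ 2·h_non(j(λ)) + 19·log 2` (`ExpEst.height_jInv_le`); the comparison of
the Weil height of `λ` with that of `j(λ) = 2^8(λ²−λ+1)³/(λ²(λ−1)²)` PROVED here place by place —
nonarchimedean: `|2|_v^8·max{1,|λ|_v}² ≤ max{1,|j(λ)|_v}` (ultrametric: for `|λ|_v > 1`, `|j(λ)|_v = |2|_v^8·|λ|_v²`);
archimedean: `max{1,|λ|_v}² ≤ 4·max{1,|j(λ)|_v}` (for `|λ| ≥ 2`, `|λ²−λ+1| ≥ |λ|²/4`, `|λ−1| ≤ 3|λ|/2`, so `|j| ≥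
(16/9)|λ|²`) — giving `2·h(λ) ≤ h(j(λ)) + 10·log 2` (`two_mul_height_le_height_jInv`; NOT a statement of [ExpEst]: it
is the elementary step behind print's passage from "finitely many `j`-invariants" to a finite set of points of the
`λ`-line, each `j` having at most six `λ`); and Northcott on `U_X(ℚ̄)^{≤d}` ([GenEll] Prop. 1.4 (iv),
`GenEll.northcott_UPle_holds`). Finsum bookkeeping as in `ExplicitEstimatesHeightsComparison.lean`. § 4: Def. 1.2's
degree bound `[F:ℚ] ≤ 2` for mono-complex `F` (`finrank_le_two_of_isMonoComplex`) and **Prop. 1.9 (iii) in its printed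
`ℚ̄`-form** (`prop19_iii`, uniform in the field — the per-field `ExpEst.finite_jInv_of_hNon_le` of
`ExplicitEstimatesHeightsComparison.lean` was weaker than print), plus § 3 without the degree parameter
(`hasFinitelyManyPoints_mcx_logQForall_le'`).
-/

noncomputable section

open scoped Classical

namespace Literature.IUT.LogVolume

namespace ExpEst

open NumberField Real Cor22 Literature.NumberTheory.DiophantineGeometry.GenEll

/-! ## 1. Place-by-place comparison of `|λ|` and `|j(λ)|` -/

section AbsValue

variable {K : Type*} [Field K] (f : AbsoluteValue K ℝ)

/-- Ultrametric "winner takes all": `f(x + y) = f(x)` when `f(y) < f(x)`. [folklore] -/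
private theorem add_eq_left_of_lt (hna : IsNonarchimedean f) {x y : K} (h : f y < f x) :
    f (x + y) = f x := by
  refine le_antisymm ((hna x y).trans (max_le le_rfl h.le)) ?_
  have h1 : f x ≤ max (f (x + y)) (f (-y)) := by
    have := hna (x + y) (-y)
    rwa [add_neg_cancel_right] at this
  rw [f.map_neg] at h1
  rcases le_max_iff.mp h1 with h2 | h2
  · exact h2
  · exact absurd h2 (not_le.mpr h)

/-- **Nonarchimedean places**: `|2|_v^8·max{1, |λ|_v}² ≤ max{1, |j(λ)|_v}` for `j(λ) = 2^8(λ²−λ+1)³/(λ²(λ−1)²)` — for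
`|λ|_v > 1` the ultrametric inequality gives `|λ²−λ+1|_v = |λ|_v²`, `|λ−1|_v = |λ|_v`, so `|j(λ)|_v = |2|_v^8·|λ|_v²`;
for `|λ|_v ≤ 1` the left side is `|2|_v^8 ≤ 1`. (The elementary step behind "finitely many `j`-invariants ⇒ finitely
many `λ`", proof of Cor. 5.2 p. 213.) [cite: MochizukiEtAl2022, Cor 5.2 proof p. 213] -/
theorem two_pow_mul_sq_max_le_max_jInv (hna : IsNonarchimedean f) (t : K) :
    f 2 ^ 8 * max 1 (f t) ^ 2 ≤ max 1 (f (jInv t)) := by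
  have h2 : f 2 ≤ 1 := by
    have := hna 1 1
    rwa [one_add_one_eq_two, f.map_one, max_self] at this
  have h28 : f 2 ^ 8 ≤ 1 := pow_le_one₀ (f.nonneg _) h2
  by_cases ht : f t ≤ 1
  · rw [max_eq_left ht, one_pow, mul_one]
    exact h28.trans (le_max_left _ _)
  rw [not_le] at ht
  have ht0 : 0 < f t := lt_trans one_pos ht
  have e1 : f (t - 1) = f t := by
    rw [sub_eq_add_neg, add_eq_left_of_lt f hna (by rw [f.map_neg, f.map_one]; exact ht)]
  have e2 : f (t ^ 2 - t + 1) = f t ^ 2 := by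
    have hlt : f t < f (t ^ 2) := by rw [map_pow]; nlinarith
    have e3 : f (t ^ 2 - t) = f t ^ 2 := by
      rw [sub_eq_add_neg, add_eq_left_of_lt f hna (by rw [f.map_neg]; exact hlt), map_pow]
    rw [add_eq_left_of_lt f hna (by rw [e3, f.map_one]; nlinarith), e3]
  have hj : f (jInv t) = f 2 ^ 8 * f t ^ 2 := by
    rw [apply_jInv]
    unfold J
    rw [e1, e2]
    field_simp
  rw [hj, max_eq_right ht.le]
  exact le_max_right _ _

/-- **Archimedean places** (`|2| = 2`): `max{1, |λ|}² ≤ 4·max{1, |j(λ)|}` — for `|λ| ≥ 2`, `|λ²−λ+1| ≥ |λ|² − |λ| − 1 ≥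
|λ|²/4` and `|λ−1| ≤ 3|λ|/2`, so `|j(λ)| = 2^8|λ²−λ+1|³/(|λ|²|λ−1|²) ≥ (16/9)|λ|² ≥ |λ|²`; for `|λ| ≤ 2` the left side
is `≤ 4`. [cite: MochizukiEtAl2022, Cor 5.2 proof p. 213] -/
theorem sq_max_le_four_mul_max_jInv (h2 : f 2 = 2) (t : K) :
    max 1 (f t) ^ 2 ≤ 4 * max 1 (f (jInv t)) := by
  have hm : 1 ≤ max 1 (f (jInv t)) := le_max_left _ _
  by_cases ht : f t ≤ 2
  · have : max 1 (f t) ≤ 2 := max_le (by norm_num) ht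
    have h0 : 0 ≤ max 1 (f t) := le_trans zero_le_one (le_max_left _ _)
    nlinarith
  rw [not_le] at ht
  set x : ℝ := f t with hx
  have hx0 : 0 < x := by linarith
  have ht1 : t ≠ 1 := by
    rintro rfl
    rw [hx, f.map_one] at ht
    norm_num at ht
  have hB0 : 0 < f (t - 1) := f.pos (sub_ne_zero.mpr ht1)
  -- `f(t - 1) ≤ x + 1 ≤ 3x/2`
  have hB : f (t - 1) ≤ x + 1 := by
    have := f.add_le t (-1)
    rw [← sub_eq_add_neg, f.map_neg, f.map_one] at this
    exact this
  -- `f(t² - t + 1) ≥ x² - x - 1 ≥ x²/4`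
  have hA : x ^ 2 - x - 1 ≤ f (t ^ 2 - t + 1) := by
    have h1 : f (t ^ 2) ≤ f (t ^ 2 - t + 1) + f (t - 1) := by
      have := f.add_le (t ^ 2 - t + 1) (t - 1)
      rwa [show t ^ 2 - t + 1 + (t - 1) = t ^ 2 by ring] at this
    rw [map_pow, ← hx] at h1
    linarith
  have hA0 : 0 < f (t ^ 2 - t + 1) := by nlinarith
  have hj : f (jInv t) = 256 * f (t ^ 2 - t + 1) ^ 3 / (x ^ 2 * f (t - 1) ^ 2) := by
    rw [apply_jInv, h2]
    unfold J
    rw [← hx]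
    ring
  -- `x² ≤ f(j)`
  have hden : 0 < x ^ 2 * f (t - 1) ^ 2 := by positivity
  have hxj : x ^ 2 ≤ f (jInv t) := by
    rw [hj, le_div_iff₀ hden]
    have hA4 : x ^ 2 / 4 ≤ f (t ^ 2 - t + 1) := by nlinarith
    have hA4' : (x ^ 2 / 4) ^ 3 ≤ f (t ^ 2 - t + 1) ^ 3 :=
      pow_le_pow_left₀ (by positivity) hA4 3
    have hB' : f (t - 1) ^ 2 ≤ (3 / 2 * x) ^ 2 :=
      pow_le_pow_left₀ hB0.le (by linarith) 2
    nlinarith [pow_pos hx0 4, mul_le_mul_of_nonneg_left hB' (by positivity : (0 : ℝ) ≤ x ^ 2 * x ^ 2)]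
  rw [max_eq_right (by linarith : (1 : ℝ) ≤ x)]
  nlinarith [le_max_right 1 (f (jInv t))]

end AbsValue

/-! ## 2. The height of `λ` against the height of `j(λ)` -/

variable {F : Type*} [Field F] [NumberField F]

/-- For `α ≠ 0`, a finite set of finite places containing those with `|α|_w ≠ 1`. [folklore] -/
private theorem exists_finset_places'' {α : F} (hα : α ≠ 0) :
    ∃ S : Finset (FinitePlace F), ∀ w : FinitePlace F, w α ≠ 1 → w ∈ S := by
  have hfin : (Function.mulSupport fun w : FinitePlace F => w α).Finite :=
    FinitePlace.hasFiniteMulSupport hα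
  exact ⟨hfin.toFinset, fun w hw => hfin.mem_toFinset.mpr hw⟩

/-- A sum over all finite places of a function vanishing off a finite set `S` is the sum over `S`. [folklore] -/
private theorem finsum_eq_sum_of_eq_zero_off' (S : Finset (FinitePlace F)) (g : FinitePlace F → ℝ)
    (hg : ∀ w, w ∉ S → g w = 0) : ∑ᶠ w, g w = ∑ w ∈ S, g w :=
  finsum_eq_sum_of_support_subset g fun w hw => by
    rw [Finset.mem_coe]; by_contra h; exact hw (hg w h)

omit [NumberField F] in
/-- At an archimedean place `|2|_w = 2`. [folklore] -/
private theorem infinitePlace_two' (w : InfinitePlace F) : w (2 : F) = 2 := by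
  simpa using InfinitePlace.map_natCast w 2

/-- Nonarchimedean part: `2·h_non(λ) ≤ h_non(j(λ)) + 8·log 2` (`λ ∉ {0,1}`; sum of `two_pow_mul_sq_max_le_max_jInv` with
`Σ_{v∤∞} log|2|_v = −[F:ℚ]·log 2`). [cite: MochizukiEtAl2022, Cor 5.2 proof p. 213] -/
theorem two_mul_hNon_le_hNon_jInv (t : F) (h0 : t ≠ 0) (h1 : t ≠ 1) :
    2 * hNon t ≤ hNon (jInv t) + 8 * Real.log 2 := by
  have hd : (0 : ℝ) < Module.finrank ℚ F := by exact_mod_cast Module.finrank_pos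
  set d : ℝ := (Module.finrank ℚ F : ℝ) with hdd
  have ht1 : t - 1 ≠ 0 := sub_ne_zero.mpr h1
  obtain ⟨S1, hS1⟩ := exists_finset_places'' h0
  obtain ⟨S2, hS2⟩ := exists_finset_places'' ht1
  obtain ⟨S3, hS3⟩ := exists_finset_places'' (two_ne_zero : (2 : F) ≠ 0)
  set S := S1 ∪ S2 ∪ S3 with hSdef
  have off : ∀ w : FinitePlace F, w ∉ S → w t = 1 ∧ w (t - 1) = 1 ∧ w (2 : F) = 1 := by
    intro w hw
    refine ⟨by_contra fun h => hw ?_, by_contra fun h => hw ?_, by_contra fun h => hw ?_⟩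
    · rw [hSdef, Finset.mem_union, Finset.mem_union]; exact Or.inl (Or.inl (hS1 w h))
    · rw [hSdef, Finset.mem_union, Finset.mem_union]; exact Or.inl (Or.inr (hS2 w h))
    · rw [hSdef, Finset.mem_union]; exact Or.inr (hS3 w h)
  have hna : ∀ w : FinitePlace F, IsNonarchimedean w.val := fun w a b => FinitePlace.add_le w a b
  -- the three finite sums
  have hA : d * hNon t = ∑ w ∈ S, log⁺ (w.val t) := by
    unfold hNon
    rw [← hdd, ← mul_assoc, mul_inv_cancel₀ hd.ne', one_mul]
    refine finsum_eq_sum_of_eq_zero_off' S _ fun w hw => ?_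
    have hx : w.val t = 1 := (off w hw).1
    change log⁺ (w.val t) = 0
    rw [hx, Real.posLog_one]
  have hB : d * hNon (jInv t) = ∑ w ∈ S, log⁺ (w.val (jInv t)) := by
    unfold hNon
    rw [← hdd, ← mul_assoc, mul_inv_cancel₀ hd.ne', one_mul]
    refine finsum_eq_sum_of_eq_zero_off' S _ fun w hw => ?_
    obtain ⟨hx, hy, h2⟩ := off w hw
    change log⁺ (w.val (jInv t)) = 0
    rw [apply_jInv, Real.posLog_eq_zero_iff]
    have h2' : w.val (2 : F) = 1 := h2
    rw [h2', one_pow, one_mul, abs_of_nonneg (J_nonneg _ _)]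
    exact J_le_one_of_apply_eq_one w.val (hna w) hx hy
  have hC : ∑ w ∈ S, Real.log (w.val (2 : F)) = -(d * Real.log 2) := by
    rw [hdd, ← finsum_log_two]
    refine (finsum_eq_sum_of_eq_zero_off' S _ fun w hw => ?_).symm
    have h2 : w.val (2 : F) = 1 := (off w hw).2.2
    change Real.log (w.val (2 : F)) = 0
    rw [h2, Real.log_one]
  -- place by place: `8·log|2|_w + 2·log⁺|λ|_w ≤ log⁺|j(λ)|_w`
  have hloc : ∀ w ∈ S, 8 * Real.log (w.val (2 : F)) + 2 * log⁺ (w.val t) ≤ log⁺ (w.val (jInv t)) := by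
    intro w _
    have h2pos : 0 < w.val (2 : F) := w.val.pos two_ne_zero
    have hm1 : 0 < max 1 (w.val t) := lt_of_lt_of_le one_pos (le_max_left _ _)
    have hm2 : 0 < max 1 (w.val (jInv t)) := lt_of_lt_of_le one_pos (le_max_left _ _)
    have h := two_pow_mul_sq_max_le_max_jInv w.val (hna w) t
    have hlog := Real.log_le_log (by positivity) h
    rw [Real.log_mul (by positivity) (by positivity), Real.log_pow, Real.log_pow] at hlog
    rw [Real.posLog_eq_log_max_one (w.val.nonneg _), Real.posLog_eq_log_max_one (w.val.nonneg _)]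
    push_cast at hlog
    linarith
  have hsum := Finset.sum_le_sum hloc
  rw [Finset.sum_add_distrib, ← Finset.mul_sum, ← Finset.mul_sum, hC, ← hA, ← hB] at hsum
  nlinarith

/-- Archimedean part: `2·h_arc(λ) ≤ h_arc(j(λ)) + 2·log 2` (sum of `sq_max_le_four_mul_max_jInv` over the infinite
places with weights `[F_v:ℝ]`). [cite: MochizukiEtAl2022, Cor 5.2 proof p. 213] -/
theorem two_mul_hArc_le_hArc_jInv (t : F) : 2 * hArc t ≤ hArc (jInv t) + 2 * Real.log 2 := by
  have hd : (0 : ℝ) < Module.finrank ℚ F := by exact_mod_cast Module.finrank_pos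
  set d : ℝ := (Module.finrank ℚ F : ℝ) with hdd
  have hsum1 : ∑ w : InfinitePlace F, (w.mult : ℝ) = d := by
    rw [hdd]; exact_mod_cast InfinitePlace.sum_mult_eq (K := F)
  have hloc : ∀ w : InfinitePlace F,
      (w.mult : ℝ) * (2 * log⁺ (w t)) ≤ (w.mult : ℝ) * (log⁺ (w (jInv t)) + 2 * Real.log 2) := by
    intro w
    refine mul_le_mul_of_nonneg_left ?_ (Nat.cast_nonneg _)
    have hm1 : 0 < max 1 (w t) := lt_of_lt_of_le one_pos (le_max_left _ _)
    have h : max 1 (w t) ^ 2 ≤ 4 * max 1 (w (jInv t)) :=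
      sq_max_le_four_mul_max_jInv w.val (infinitePlace_two' w) t
    have hlog := Real.log_le_log (by positivity) h
    rw [Real.log_pow, Real.log_mul (by norm_num) (by positivity), show (4 : ℝ) = 2 ^ 2 by norm_num,
      Real.log_pow] at hlog
    rw [Real.posLog_eq_log_max_one (apply_nonneg w t), Real.posLog_eq_log_max_one (apply_nonneg w _)]
    push_cast at hlog
    linarith
  have hs := Finset.sum_le_sum fun w (_ : w ∈ Finset.univ) => hloc w
  have hda : ∀ x : F, d * hArc x = ∑ w : InfinitePlace F, (w.mult : ℝ) * log⁺ (w x) := by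
    intro x
    unfold hArc
    rw [← hdd, ← mul_assoc, mul_inv_cancel₀ hd.ne', one_mul]
  have e1 : ∑ w : InfinitePlace F, (w.mult : ℝ) * (2 * log⁺ (w t)) = 2 * (d * hArc t) := by
    rw [hda, Finset.mul_sum]
    exact Finset.sum_congr rfl fun w _ => by ring
  have e2 : ∑ w : InfinitePlace F, (w.mult : ℝ) * (log⁺ (w (jInv t)) + 2 * Real.log 2) =
      d * hArc (jInv t) + d * (2 * Real.log 2) := by
    rw [hda, ← hsum1, Finset.sum_mul, ← Finset.sum_add_distrib]
    exact Finset.sum_congr rfl fun w _ => by ring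
  rw [e1, e2] at hs
  nlinarith

/-- **`2·h(λ) ≤ h(j(λ)) + 10·log 2`** for `λ ∉ {0,1}` in a number field (`h` the Weil height of [ExpEst] Def. 1.1 (i)): the
height of a point of the `λ`-line is bounded by the height of its `j`-invariant — so a bound on `h(j(λ))` leaves finitely
many `λ` in each degree. [cite: MochizukiEtAl2022, Cor 5.2 proof p. 213] -/
theorem two_mul_height_le_height_jInv (t : F) (h0 : t ≠ 0) (h1 : t ≠ 1) :
    2 * height t ≤ height (jInv t) + 10 * Real.log 2 := by
  unfold height
  have ha := two_mul_hNon_le_hNon_jInv t h0 h1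
  have hb := two_mul_hArc_le_hArc_jInv t
  linarith

/-! ## 3. The exceptional sets of Cor. 5.2 (mono-complex version) are finite -/

/-- `[GenEll]`'s height `ht` of a presented point of the `λ`-line is [ExpEst]'s Weil height `h(λ)` (both are
`[F:ℚ]⁻¹·h_F(λ)`, Mathlib `logHeight₁`). [cite: MochizukiEtAl2022, Def 1.1 (i) p. 184] -/
theorem ht_eq_height (P : NFPoint) : P.ht = height P.x := by
  rw [height_eq_logHeight₁_div]
  unfold NFPoint.ht NFPoint.degree
  rw [div_eq_inv_mul]

/-- **"There is only a finite number of possibilities for the `j`-invariant of `E_F`. Thus, by possibly enlarging the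
finite set `𝔈𝔵𝔠^mcx_{d,ε}` …"** (proof of Cor. 5.2, pp. 213, 215, 218; via "Proposition 1.9, (iii)"), in the form the
tree's `ExpEst.PartMcx` consumes: for every `d` and `B`, the minimally presented points `λ ∈ U_X(ℚ̄)^{≤d}` over a
mono-complex field (Def. 1.2) with `log(𝔮^∀(λ)) ≤ B` are finitely many (`GenEll.HasFinitelyManyPoints`). PROVED:
`log(𝔮^∀) = h_non(j(λ))` (Rmk 1.10.1, `logQForall_eq_hNon`), Prop. 1.9 (`height_jInv_le`: `h(j) ≤ 2·h_non(j) + 19·log 2`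
over a mono-complex field), `2·h(λ) ≤ h(j(λ)) + 10·log 2`, and Northcott on `U_X(ℚ̄)^{≤d}` ([GenEll] Prop. 1.4 (iv),
`northcott_UPle_holds`). [cite: MochizukiEtAl2022, Cor 5.2 proof p. 213] -/
theorem hasFinitelyManyPoints_mcx_logQForall_le (d : ℕ) (B : ℝ) :
    HasFinitelyManyPoints {P | P ∈ UPle d ∧ IsMonoComplex P.F ∧ logQForall P ≤ B} := by
  refine (northcott_UPle_holds d (B + 29 / 2 * Real.log 2)).mono ?_
  rintro P ⟨hPd, hmc, hB⟩
  refine ⟨hPd, ?_⟩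
  have hU : P.InU := hPd.1.1
  rw [ht_eq_height]
  have h1 : hNon (jInv P.x) ≤ B := by rw [← logQForall_eq_hNon]; exact hB
  have h2 := height_jInv_le hmc P.x hU.1 hU.2
  have h3 := two_mul_height_le_height_jInv P.x hU.1 hU.2
  linarith

/-! ## 4. [ExpEst] Def. 1.2 "ℚ or imaginary quadratic" and Prop. 1.9 (iii) in its printed `ℚ̄`-form -/

/-- **[ExpEst] Definition 1.2**, the degree bound: a mono-complex number field ("either the field of rational numbers
`ℚ` or an imaginary quadratic field … if and only if the cardinality of `𝕍(F)^arc` is one") has `[F:ℚ] ≤ 2` — from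
`Σ_{w∣∞} [F_w:ℝ] = [F:ℚ]` (Mathlib `InfinitePlace.sum_mult_eq`) with a single archimedean place of local degree `≤ 2`.
[cite: MochizukiEtAl2022, Def 1.2 p. 185] -/
theorem finrank_le_two_of_isMonoComplex (hF : IsMonoComplex F) : Module.finrank ℚ F ≤ 2 := by
  rw [← InfinitePlace.sum_mult_eq (K := F)]
  obtain ⟨w₀, hw₀⟩ := Fintype.card_eq_one_iff.mp hF
  have hu : (Finset.univ : Finset (InfinitePlace F)) = {w₀} := by
    ext w
    simp [hw₀ w]
  rw [hu, Finset.sum_singleton]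
  unfold InfinitePlace.mult
  split_ifs <;> norm_num

omit [NumberField F] in
/-- A presented point over a mono-complex field has degree `≤ 2` (Def. 1.2). [cite: MochizukiEtAl2022, Def 1.2 p. 185] -/
theorem degree_le_two_of_isMonoComplex (P : NFPoint) (hP : IsMonoComplex P.F) : P.degree ≤ 2 :=
  finrank_le_two_of_isMonoComplex hP

omit [NumberField F] in
/-- **[ExpEst] Proposition 1.9 (iii)** in its printed `ℚ̄`-form ("In the notation of Definition 1.7, suppose that
`ℚ(λ)` is mono-complex. … (iii) If `C ∈ ℝ`, then the element `j(E) ∈ ℚ̄` is completely determined up to a finite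
number of possibilities by the condition `h_non(−) ≤ C`"), at the level of the Legendre parameter: the minimally
presented `λ ∈ U_X(ℚ̄)` (`ℚ(λ) = F`, [GenEll] Def. 1.5 (i)) with `ℚ(λ)` mono-complex and `h_non(j(λ)) ≤ C` have finitely
many minimal polynomials (`GenEll.HasFinitelyManyPoints`) — hence finitely many `j(λ)`; conversely each `j` has at
most six `λ`. PROVED (uniformly in the field, which the per-field `ExpEst.finite_jInv_of_hNon_le` was not): Def. 1.2
bounds the degree by `2`, then § 3. [cite: MochizukiEtAl2022, Prop 1.9 (iii) p. 192] -/
theorem prop19_iii (C : ℝ) : HasFinitelyManyPoints {P | P ∈ UP ∧ IsMonoComplex P.F ∧ hNon (jInv P.x) ≤ C} := by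
  refine (hasFinitelyManyPoints_mcx_logQForall_le 2 C).mono ?_
  rintro P ⟨hP, hmc, hC⟩
  refine ⟨⟨hP, degree_le_two_of_isMonoComplex P hmc⟩, hmc, ?_⟩
  rw [logQForall_eq_hNon]
  exact hC

omit [NumberField F] in
/-- The exceptional-set finiteness of § 3 without the degree parameter: over mono-complex fields the degree is `≤ 2`
(Def. 1.2), so `{λ ∈ U_X(ℚ̄) minimally presented over a mono-complex field, log(𝔮^∀(λ)) ≤ B}` has finitely many points.
[cite: MochizukiEtAl2022, Cor 5.2 proof p. 213] -/
theorem hasFinitelyManyPoints_mcx_logQForall_le' (B : ℝ) :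
    HasFinitelyManyPoints {P | P ∈ UP ∧ IsMonoComplex P.F ∧ logQForall P ≤ B} := by
  refine (hasFinitelyManyPoints_mcx_logQForall_le 2 B).mono ?_
  rintro P ⟨hP, hmc, hB⟩
  exact ⟨⟨hP, degree_le_two_of_isMonoComplex P hmc⟩, hmc, hB⟩

end ExpEst

end Literature.IUT.LogVolume

end
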